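import Mathlib
import Literature.NumberTheory.Transcendental.KZGreenBandMove
import Literature.NumberTheory.Transcendental.KZSemialgebraicComplex
import Literature.NumberTheory.Transcendental.KZPeriodsProofs
import HarnessLib
import HarnessLib.Audit

/-!
# SoloInformed — homotopy lemma for logarithmic-derivative representations, preparations

Solo programme `solo-KontsevichZagierPeriods-informed`, session s112: first file of the kernel
project «the Kontsevich–Zagier period conjecture for rational one-dimensional representations,
unconditionally» (`SoloInformedKZPUpTo 1` of file `SoloInformedPresRat`, with the tree's KERNEL
Baker theorem `Literature.NumberTheory.Transcendental.baker_decomposition_complex` as the only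
transcendence input).

After partial fractions every rational one-variable period is a sum of algebraic constants and of
PATH REPRESENTATIONS `[[0,1], Re(g · V′(s)/V(s))]` — the real part of `g d log V` along a
polynomial path `V ∈ ℚ̄[s]` avoiding `0` (`g ∈ ℚ̄`; for the segment `V(s) = 1 + (c − 1)s` the value is
`Re(g · Log c)`).  The homotopy lemma (next file, `SoloInformedPathHomotopy`) moves between two such
paths with the same end points by Green's formula on the square `[0,1]²` inside KZ's moves.  This
file prepares it: the unit interval / square as bands, semialgebraicity of real and imaginary parts
of `ℚ̄`-polynomials along a semialgebraic function, the straight homotopy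
`H(s,t) = (1 − t)V₀(s) + tV₁(s)`, its partial derivatives, the Green primitives
`P = Re(g ∂ₛH/H)`, `Q = Re(g ∂ₜH/H)` and their common derivative
`F = ∂ₜP = ∂ₛQ = Re(g (∂ₛ∂ₜH · H − ∂ₛH ∂ₜH)/H²)` (semialgebraic and continuous on the square).

References: M. Kontsevich, D. Zagier, *Periods* (2001), §1.2, rule (3) («Stokes»);
J. Bochnak, M. Coste, M.-F. Roy, *Real Algebraic Geometry* (1998), §2.2.
-/

noncomputable section

open scoped BigOperators Polynomial ComplexConjugate
open MeasureTheory Set Filter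
open Literature.ModelTheory.ExponentialFields
open Literature.NumberTheory.Transcendental Literature.NumberTheory.Transcendental.KZ

namespace Summit.KontsevichZagierPeriods.KontsevichZagierPeriods.Theorems

/-! ### The unit interval and the unit square as bands -/

/-- The unit interval `[0,1] ⊆ ℝ¹` as a band over the point `ℝ⁰` (the shape required by the
Newton–Leibniz and Green moves). [Kontsevich–Zagier 2001, §1.2] -/
def soloInformedUnitBand : Set (Fin 1 → ℝ) :=
  KZlog.band (univ : Set (Fin 0 → ℝ)) (fun _ => 0) (fun _ => 1)

/-- Membership in the unit band. -/
theorem soloInformed_mem_unitBand {y : Fin 1 → ℝ} :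
    y ∈ soloInformedUnitBand ↔ 0 ≤ y 0 ∧ y 0 ≤ 1 := by
  simp only [soloInformedUnitBand, KZlog.mem_band, mem_univ, true_and]
  rfl

/-- The base point `ℝ⁰` is `ℚ`-semialgebraic. -/
theorem soloInformed_isSemialgebraic_univ_zero : IsSemialgebraic ℚ (univ : Set (Fin 0 → ℝ)) :=
  isSemialgebraic_univ

/-- Constant rational functions on the base point are semialgebraic (edge functions of bands). -/
theorem soloInformed_isSemialgebraicFunOn_const_zero (q : ℚ) :
    IsSemialgebraicFunOn ℚ (univ : Set (Fin 0 → ℝ)) (fun _ => (q : ℝ)) :=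
  isSemialgebraicFunOn_ratCast isSemialgebraic_univ q

/-- The edge `0` on the base point. -/
theorem soloInformed_isSemialgebraicFunOn_zero_base :
    IsSemialgebraicFunOn ℚ (univ : Set (Fin 0 → ℝ)) (fun _ => (0 : ℝ)) := by
  simpa using soloInformed_isSemialgebraicFunOn_const_zero 0

/-- The edge `1` on the base point. -/
theorem soloInformed_isSemialgebraicFunOn_one_base :
    IsSemialgebraicFunOn ℚ (univ : Set (Fin 0 → ℝ)) (fun _ => (1 : ℝ)) := by
  simpa using soloInformed_isSemialgebraicFunOn_const_zero 1

/-- The unit band is `ℚ`-semialgebraic. -/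
theorem soloInformed_isSemialgebraic_unitBand : IsSemialgebraic ℚ soloInformedUnitBand :=
  KZlog.isSemialgebraic_band soloInformed_isSemialgebraicFunOn_zero_base
    soloInformed_isSemialgebraicFunOn_one_base

/-- The edge `0` on the unit band. -/
theorem soloInformed_isSemialgebraicFunOn_zero_unitBand :
    IsSemialgebraicFunOn ℚ soloInformedUnitBand (fun _ => (0 : ℝ)) := by
  simpa using isSemialgebraicFunOn_ratCast soloInformed_isSemialgebraic_unitBand 0

/-- The edge `1` on the unit band. -/
theorem soloInformed_isSemialgebraicFunOn_one_unitBand :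
    IsSemialgebraicFunOn ℚ soloInformedUnitBand (fun _ => (1 : ℝ)) := by
  simpa using isSemialgebraicFunOn_ratCast soloInformed_isSemialgebraic_unitBand 1

/-- The unit square `[0,1]² ⊆ ℝ²` as a band over the unit band (last coordinate the homotopy
parameter). [Kontsevich–Zagier 2001, §1.2] -/
def soloInformedUnitSquare : Set (Fin 2 → ℝ) :=
  KZlog.band soloInformedUnitBand (fun _ => 0) (fun _ => 1)

/-- Membership in the unit square. -/
theorem soloInformed_mem_unitSquare {w : Fin 2 → ℝ} :
    w ∈ soloInformedUnitSquare ↔ (0 ≤ w 0 ∧ w 0 ≤ 1) ∧ 0 ≤ w 1 ∧ w 1 ≤ 1 := by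
  simp only [soloInformedUnitSquare, KZlog.mem_band, soloInformed_mem_unitBand]
  rfl

/-- The unit square is `ℚ`-semialgebraic. -/
theorem soloInformed_isSemialgebraic_unitSquare : IsSemialgebraic ℚ soloInformedUnitSquare :=
  KZlog.isSemialgebraic_band soloInformed_isSemialgebraicFunOn_zero_unitBand
    soloInformed_isSemialgebraicFunOn_one_unitBand

/-- The unit square is the order interval `[0, 1]` of `ℝ²`. -/
theorem soloInformed_unitSquare_eq_Icc : soloInformedUnitSquare = Icc (0 : Fin 2 → ℝ) 1 := by
  ext w
  rw [soloInformed_mem_unitSquare, mem_Icc, Pi.le_def, Pi.le_def, Fin.forall_fin_two,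
    Fin.forall_fin_two]
  simp only [Pi.zero_apply, Pi.one_apply]
  tauto

/-- The unit square is compact. -/
theorem soloInformed_isCompact_unitSquare : IsCompact soloInformedUnitSquare := by
  rw [soloInformed_unitSquare_eq_Icc]
  exact isCompact_Icc

/-! ### Real and imaginary parts of `ℚ̄`-polynomials along a semialgebraic function -/

/-- **Semialgebraicity of `ℚ̄`-polynomial evaluations.** If `V ∈ ℂ[X]` has algebraic
coefficients and `f` is a real `ℚ`-semialgebraic function on `s`, then `x ↦ Re V(f x)` and
`x ↦ Im V(f x)` are `ℚ`-semialgebraic on `s` (finite sum of `Re/Im (cᵢ · (f x)ⁱ)`).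
[Bochnak–Coste–Roy 1998, Prop. 2.2.6; Kontsevich–Zagier 2001, §1.1 («algebraic» coefficients)] -/
theorem soloInformed_re_im_polyEval {m : ℕ} {s : Set (Fin m → ℝ)} (hs : IsSemialgebraic ℚ s)
    (V : ℂ[X]) (hV : ∀ n, IsAlgebraic ℚ (V.coeff n)) {f : (Fin m → ℝ) → ℝ}
    (hf : IsSemialgebraicFunOn ℚ s f) :
    IsSemialgebraicFunOn ℚ s (fun x => (V.eval ((f x : ℝ) : ℂ)).re) ∧
      IsSemialgebraicFunOn ℚ s (fun x => (V.eval ((f x : ℝ) : ℂ)).im) := by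
  have key : ∀ x, V.eval ((f x : ℝ) : ℂ) =
      ∑ i ∈ Finset.range (V.natDegree + 1), V.coeff i * ((f x : ℝ) : ℂ) ^ i :=
    fun x => Polynomial.eval_eq_sum_range _
  have hterm : ∀ i : ℕ, IsSemialgebraicFunOn ℚ s (fun x => (V.coeff i * ((f x : ℝ) : ℂ) ^ i).re) ∧
      IsSemialgebraicFunOn ℚ s (fun x => (V.coeff i * ((f x : ℝ) : ℂ) ^ i).im) := fun i =>
    re_im_mul (re_im_const hs (isAlgebraic_re_im (hV i)).1 (isAlgebraic_re_im (hV i)).2)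
      (re_im_pow hs (re_im_ofReal hs hf) i)
  refine ⟨?_, ?_⟩
  · refine (isSemialgebraicFunOn_finset_sum (Finset.range (V.natDegree + 1)) hs
      (fun i _ => (hterm i).1)).congr fun x _ => ?_
    rw [key, Complex.re_sum]
  · refine (isSemialgebraicFunOn_finset_sum (Finset.range (V.natDegree + 1)) hs
      (fun i _ => (hterm i).2)).congr fun x _ => ?_
    rw [key, Complex.im_sum]

/-- The derivative of a polynomial with algebraic coefficients has algebraic coefficients. -/
theorem soloInformed_isAlgebraic_coeff_derivative {V : ℂ[X]} (hV : ∀ n, IsAlgebraic ℚ (V.coeff n))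
    (n : ℕ) : IsAlgebraic ℚ (V.derivative.coeff n) := by
  rw [Polynomial.coeff_derivative]
  exact (hV (n + 1)).mul (by exact_mod_cast isAlgebraic_algebraMap ((n : ℚ) + 1))


/-! ### The straight homotopy between two polynomial paths -/

/-- `H(s,t) = (1 − t)·V₀(s) + t·V₁(s)` at the point `w = (s,t)` of the square: the straight
homotopy between the polynomial paths `V₀` and `V₁`. -/
def soloInformedHomC (V₀ V₁ : ℂ[X]) (w : Fin 2 → ℝ) : ℂ :=
  ((1 - w 1 : ℝ) : ℂ) * V₀.eval ((w 0 : ℝ) : ℂ) + ((w 1 : ℝ) : ℂ) * V₁.eval ((w 0 : ℝ) : ℂ)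

/-- `∂ₛH(s,t) = (1 − t)·V₀′(s) + t·V₁′(s)`. -/
def soloInformedHomS (V₀ V₁ : ℂ[X]) (w : Fin 2 → ℝ) : ℂ :=
  ((1 - w 1 : ℝ) : ℂ) * V₀.derivative.eval ((w 0 : ℝ) : ℂ) +
    ((w 1 : ℝ) : ℂ) * V₁.derivative.eval ((w 0 : ℝ) : ℂ)

/-- `∂ₜH(s,t) = V₁(s) − V₀(s)`. -/
def soloInformedHomT (V₀ V₁ : ℂ[X]) (w : Fin 2 → ℝ) : ℂ :=
  V₁.eval ((w 0 : ℝ) : ℂ) - V₀.eval ((w 0 : ℝ) : ℂ)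

/-- `∂ₛ∂ₜH(s,t) = V₁′(s) − V₀′(s)`. -/
def soloInformedHomST (V₀ V₁ : ℂ[X]) (w : Fin 2 → ℝ) : ℂ :=
  V₁.derivative.eval ((w 0 : ℝ) : ℂ) - V₀.derivative.eval ((w 0 : ℝ) : ℂ)

/-- `P(s,t) = Re(g · ∂ₛH/H)`: the first Green primitive (the pulled-back `1`-form's `ds`-part). -/
def soloInformedHomP (g : ℂ) (V₀ V₁ : ℂ[X]) (w : Fin 2 → ℝ) : ℝ :=
  (g * (soloInformedHomS V₀ V₁ w / soloInformedHomC V₀ V₁ w)).re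

/-- `Q(s,t) = Re(g · ∂ₜH/H)`: the second Green primitive (the `dt`-part). -/
def soloInformedHomQ (g : ℂ) (V₀ V₁ : ℂ[X]) (w : Fin 2 → ℝ) : ℝ :=
  (g * (soloInformedHomT V₀ V₁ w / soloInformedHomC V₀ V₁ w)).re

/-- `F = ∂ₜP = ∂ₛQ = Re(g · (∂ₛ∂ₜH · H − ∂ₛH · ∂ₜH)/H²)`: the common mixed derivative (closedness
of `g · dH/H`). -/
def soloInformedHomF (g : ℂ) (V₀ V₁ : ℂ[X]) (w : Fin 2 → ℝ) : ℝ :=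
  (g * ((soloInformedHomST V₀ V₁ w * soloInformedHomC V₀ V₁ w -
    soloInformedHomS V₀ V₁ w * soloInformedHomT V₀ V₁ w) / soloInformedHomC V₀ V₁ w ^ 2)).re

/-- The coordinate functions are semialgebraic on the unit square. -/
theorem soloInformed_isSemialgebraicFunOn_unitSquare_coord (i : Fin 2) :
    IsSemialgebraicFunOn ℚ soloInformedUnitSquare (fun w => w i) :=
  (isSemialgebraicFunOn_aeval soloInformed_isSemialgebraic_unitSquare (MvPolynomial.X i)).congr
    fun w _ => by simp

/-- `w ↦ 1 − t` is semialgebraic on the unit square. -/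
theorem soloInformed_isSemialgebraicFunOn_unitSquare_one_sub :
    IsSemialgebraicFunOn ℚ soloInformedUnitSquare (fun w => 1 - w 1) :=
  (isSemialgebraicFunOn_aeval soloInformed_isSemialgebraic_unitSquare
    (1 - MvPolynomial.X 1)).congr fun w _ => by simp

section Homotopy

variable {g : ℂ} {V₀ V₁ : ℂ[X]}

/-- Real and imaginary parts of `H` are semialgebraic on the square. -/
theorem soloInformed_re_im_homC (hV₀ : ∀ n, IsAlgebraic ℚ (V₀.coeff n))
    (hV₁ : ∀ n, IsAlgebraic ℚ (V₁.coeff n)) :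
    IsSemialgebraicFunOn ℚ soloInformedUnitSquare (fun w => (soloInformedHomC V₀ V₁ w).re) ∧
      IsSemialgebraicFunOn ℚ soloInformedUnitSquare (fun w => (soloInformedHomC V₀ V₁ w).im) := by
  unfold soloInformedHomC
  exact re_im_add
    (re_im_mul (re_im_ofReal soloInformed_isSemialgebraic_unitSquare
      soloInformed_isSemialgebraicFunOn_unitSquare_one_sub)
      (soloInformed_re_im_polyEval soloInformed_isSemialgebraic_unitSquare V₀ hV₀
        (soloInformed_isSemialgebraicFunOn_unitSquare_coord 0)))
    (re_im_mul (re_im_ofReal soloInformed_isSemialgebraic_unitSquare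
      (soloInformed_isSemialgebraicFunOn_unitSquare_coord 1))
      (soloInformed_re_im_polyEval soloInformed_isSemialgebraic_unitSquare V₁ hV₁
        (soloInformed_isSemialgebraicFunOn_unitSquare_coord 0)))

/-- Real and imaginary parts of `∂ₛH` are semialgebraic on the square. -/
theorem soloInformed_re_im_homS (hV₀ : ∀ n, IsAlgebraic ℚ (V₀.coeff n))
    (hV₁ : ∀ n, IsAlgebraic ℚ (V₁.coeff n)) :
    IsSemialgebraicFunOn ℚ soloInformedUnitSquare (fun w => (soloInformedHomS V₀ V₁ w).re) ∧
      IsSemialgebraicFunOn ℚ soloInformedUnitSquare (fun w => (soloInformedHomS V₀ V₁ w).im) := by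
  unfold soloInformedHomS
  exact re_im_add
    (re_im_mul (re_im_ofReal soloInformed_isSemialgebraic_unitSquare
      soloInformed_isSemialgebraicFunOn_unitSquare_one_sub)
      (soloInformed_re_im_polyEval soloInformed_isSemialgebraic_unitSquare _
        (soloInformed_isAlgebraic_coeff_derivative hV₀)
        (soloInformed_isSemialgebraicFunOn_unitSquare_coord 0)))
    (re_im_mul (re_im_ofReal soloInformed_isSemialgebraic_unitSquare
      (soloInformed_isSemialgebraicFunOn_unitSquare_coord 1))
      (soloInformed_re_im_polyEval soloInformed_isSemialgebraic_unitSquare _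
        (soloInformed_isAlgebraic_coeff_derivative hV₁)
        (soloInformed_isSemialgebraicFunOn_unitSquare_coord 0)))

/-- Real and imaginary parts of `∂ₜH` are semialgebraic on the square. -/
theorem soloInformed_re_im_homT (hV₀ : ∀ n, IsAlgebraic ℚ (V₀.coeff n))
    (hV₁ : ∀ n, IsAlgebraic ℚ (V₁.coeff n)) :
    IsSemialgebraicFunOn ℚ soloInformedUnitSquare (fun w => (soloInformedHomT V₀ V₁ w).re) ∧
      IsSemialgebraicFunOn ℚ soloInformedUnitSquare (fun w => (soloInformedHomT V₀ V₁ w).im) := by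
  unfold soloInformedHomT
  exact re_im_sub
    (soloInformed_re_im_polyEval soloInformed_isSemialgebraic_unitSquare V₁ hV₁
      (soloInformed_isSemialgebraicFunOn_unitSquare_coord 0))
    (soloInformed_re_im_polyEval soloInformed_isSemialgebraic_unitSquare V₀ hV₀
      (soloInformed_isSemialgebraicFunOn_unitSquare_coord 0))

/-- Real and imaginary parts of `∂ₛ∂ₜH` are semialgebraic on the square. -/
theorem soloInformed_re_im_homST (hV₀ : ∀ n, IsAlgebraic ℚ (V₀.coeff n))
    (hV₁ : ∀ n, IsAlgebraic ℚ (V₁.coeff n)) :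
    IsSemialgebraicFunOn ℚ soloInformedUnitSquare (fun w => (soloInformedHomST V₀ V₁ w).re) ∧
      IsSemialgebraicFunOn ℚ soloInformedUnitSquare (fun w => (soloInformedHomST V₀ V₁ w).im) := by
  unfold soloInformedHomST
  exact re_im_sub
    (soloInformed_re_im_polyEval soloInformed_isSemialgebraic_unitSquare _
      (soloInformed_isAlgebraic_coeff_derivative hV₁)
      (soloInformed_isSemialgebraicFunOn_unitSquare_coord 0))
    (soloInformed_re_im_polyEval soloInformed_isSemialgebraic_unitSquare _
      (soloInformed_isAlgebraic_coeff_derivative hV₀)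
      (soloInformed_isSemialgebraicFunOn_unitSquare_coord 0))

/-- On the square the homotopy does not vanish (hypothesis `hH` in coordinates). -/
theorem soloInformed_homC_ne_zero
    (hH : ∀ s ∈ Icc (0 : ℝ) 1, ∀ t ∈ Icc (0 : ℝ) 1,
      (1 - (t : ℂ)) * V₀.eval (s : ℂ) + (t : ℂ) * V₁.eval (s : ℂ) ≠ 0)
    {w : Fin 2 → ℝ} (hw : w ∈ soloInformedUnitSquare) : soloInformedHomC V₀ V₁ w ≠ 0 := by
  obtain ⟨⟨h0, h0'⟩, h1, h1'⟩ := soloInformed_mem_unitSquare.1 hw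
  have := hH (w 0) ⟨h0, h0'⟩ (w 1) ⟨h1, h1'⟩
  simpa [soloInformedHomC, Complex.ofReal_sub] using this

/-- The mixed derivative `F` is semialgebraic on the square. -/
theorem soloInformed_isSemialgebraicFunOn_homF (hg : IsAlgebraic ℚ g)
    (hV₀ : ∀ n, IsAlgebraic ℚ (V₀.coeff n)) (hV₁ : ∀ n, IsAlgebraic ℚ (V₁.coeff n))
    (hH : ∀ s ∈ Icc (0 : ℝ) 1, ∀ t ∈ Icc (0 : ℝ) 1,
      (1 - (t : ℂ)) * V₀.eval (s : ℂ) + (t : ℂ) * V₁.eval (s : ℂ) ≠ 0) :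
    IsSemialgebraicFunOn ℚ soloInformedUnitSquare (soloInformedHomF g V₀ V₁) := by
  have h0' : ∀ w ∈ soloInformedUnitSquare, soloInformedHomC V₀ V₁ w ^ 2 ≠ 0 := fun w hw =>
    pow_ne_zero _ (soloInformed_homC_ne_zero hH hw)
  have key := re_im_mul (re_im_const soloInformed_isSemialgebraic_unitSquare
      (isAlgebraic_re_im hg).1 (isAlgebraic_re_im hg).2)
    (re_im_div (re_im_sub (re_im_mul (soloInformed_re_im_homST hV₀ hV₁)
      (soloInformed_re_im_homC hV₀ hV₁))
      (re_im_mul (soloInformed_re_im_homS hV₀ hV₁) (soloInformed_re_im_homT hV₀ hV₁)))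
      (re_im_pow soloInformed_isSemialgebraic_unitSquare (soloInformed_re_im_homC hV₀ hV₁) 2) h0')
  exact key.1

/-- The mixed derivative `F` is continuous on the square. -/
theorem soloInformed_continuousOn_homF
    (hH : ∀ s ∈ Icc (0 : ℝ) 1, ∀ t ∈ Icc (0 : ℝ) 1,
      (1 - (t : ℂ)) * V₀.eval (s : ℂ) + (t : ℂ) * V₁.eval (s : ℂ) ≠ 0) :
    ContinuousOn (soloInformedHomF g V₀ V₁) soloInformedUnitSquare := by
  have c0 : Continuous fun w : Fin 2 → ℝ => ((w 0 : ℝ) : ℂ) :=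
    Complex.continuous_ofReal.comp (continuous_apply 0)
  have c1 : Continuous fun w : Fin 2 → ℝ => ((w 1 : ℝ) : ℂ) :=
    Complex.continuous_ofReal.comp (continuous_apply 1)
  have c1' : Continuous fun w : Fin 2 → ℝ => ((1 - w 1 : ℝ) : ℂ) :=
    Complex.continuous_ofReal.comp (continuous_const.sub (continuous_apply 1))
  have cV : ∀ V : ℂ[X], Continuous fun w : Fin 2 → ℝ => V.eval ((w 0 : ℝ) : ℂ) := fun V =>
    V.continuous.comp c0
  have cC : Continuous (soloInformedHomC V₀ V₁) := (c1'.mul (cV V₀)).add (c1.mul (cV V₁))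
  have cS : Continuous (soloInformedHomS V₀ V₁) := (c1'.mul (cV _)).add (c1.mul (cV _))
  have cT : Continuous (soloInformedHomT V₀ V₁) := (cV V₁).sub (cV V₀)
  have cST : Continuous (soloInformedHomST V₀ V₁) := (cV _).sub (cV _)
  have h0' : ∀ w ∈ soloInformedUnitSquare, soloInformedHomC V₀ V₁ w ^ 2 ≠ 0 := fun w hw =>
    pow_ne_zero _ (soloInformed_homC_ne_zero hH hw)
  have key : ContinuousOn (fun w => g * ((soloInformedHomST V₀ V₁ w * soloInformedHomC V₀ V₁ w -
      soloInformedHomS V₀ V₁ w * soloInformedHomT V₀ V₁ w) / soloInformedHomC V₀ V₁ w ^ 2))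
      soloInformedUnitSquare :=
    continuousOn_const.mul ((((cST.mul cC).sub (cS.mul cT)).continuousOn).div
      (cC.pow 2).continuousOn h0')
  exact Complex.continuous_re.comp_continuousOn key

end Homotopy

end Summit.KontsevichZagierPeriods.KontsevichZagierPeriods.Theorems
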